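import Summits.Schanuel.Schanuel.Theorems.RootDecomp1KSiegelGenusOne05

/-!
# RootDecomp1KHyperellipticSiegel — lens 1, generation 62, NODE 23 «HYPERELLIPTIC SIEGEL ON THE K-LINE — the dominant live sector» (Siegel's theorem for y² = f(x), f separable of degree ≥ 3, over any number field — AEC IX.4.3 — PROVED from the tree's unit equation and cubic case; the engine on DOMINANT x-degree-2 pairs c₂x² + c₁x + c₀ (deg c₁, deg c₂ < deg c₀) with separable x-discriminant of degree ≥ 3 ⇒ SiegelClause / LevelFinite / ThinFibreAt ∀ m₀ / BddLevelEmpty, intrinsically the class DomHyper P; the genus-two family M j := x² + 3Y·x + (Y⁵ + 9jY + 9j + 3) decided hypothesis-free ∀ j ∈ ℤ; the territory M_territory incl. 2-adic liveness by size at m₀ = 2; CLAIM L2879, PRICE L2882, K-R54) — part 1 (RootDecomp1KHyperellipticSiegel01): §L Siegel's theorem for y² = f(x) in full from the unit equation: the n-root parity lemma (section Parity), the cofactor lemma (section Cofactor), the bad places, the Kummer/Selmer field tower, finite_integer_sq_eq_of_unitEquation (U-binder verbatim), finite_integer_sq_eq (unconditional)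

(lens-1 g62 NODE 23 «HYPERELLIPTIC SIEGEL ON THE K-LINE — the DOMINANT LIVE SECTOR» L2903: HOME kernel K = HOME/decomp-schanuel-lens-1/g62/lean/HyperellipticSiegel.lean sha256 f4b0f073…, 1239 l, 124 theorems + 8 defs, ONE namespace `Summit.Schanuel.Schanuel.Theorems.RootDecomp1KHyperellipticSiegel`, imports the tree port …RootDecomp1KSiegelGenusOne05 ONLY (the PROVED Literature modules Literature.NumberTheory.DiophantineGeometry.{SiegelCubicReduction, UnitEquationFinite, SIntegersFiniteExtension} and EllipticCurves.{KummerSelmerGroupFinite, TwoDescentParity} arrive transitively, BUILT; no …Proofs umbrella, no fact file); no private, no instance, no set_option, no notation, no sorry, no native_decide / decide; farm of record (lens): K rc 0 · 0 errors · 0 sorries, Probe rc 0 (211 `#print axioms` guards, standard triple), Ctrl0 rc 0, Ctrl rc 1 = 42 planted errors exactly; CLAIM L2879, crit g11 PRICE L2882 (PAYABLE THEOREM ×1 EX ANTE for (L)+(E)+(F)+(T) jointly under K-R53 (iii) prong 4; CHECKLIST K-g62 (1)–(11); RULE K-R54 PRE-ANNOUNCED), census LIVENESS-v24/v25/v26 (rows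 M 67 / M 144 / X3; keys hsE / galq / genus_torus of record L2882 / L2893 / L2897), crit g12 RULING L2893 (X3 = standing witness of the dominant-far sector), ADVANCE NOTICE L2901 (a) (engine generality DomZero 2), writer g32/g33 NOTES 14 / 1 / 2 / 4 (pre-kernel arithmetic incl. the real place; X3 certificate; DomHyper flips), critic VERDICT (crit g12): CLEARED — THEOREM ×1 for (L)+(E)+(F)+(T) JOINTLY, ONE credit (K-R53 (iii) prong 4), VERDICT L2907 (crit g12): CHECKLIST K-g62 (1)–(11) met item by item on the critic's own farm runs (K c679d0af… rc 0 · 0 errors · 0 sorries; Probe a3866a38… rc 0 with 211 `#print axioms` guards ⊆ the standard triple; Ctrl0 rc 0; Ctrl rc 1 = exactly the 42 planted errors; L_standalone rc 0 ⇒ §L uses nothing from the K-line); ERRATUM OF RECORD E1 = lens ADDENDUM 1 L2904 (memo only: (E) as typed = node 15's c₀-dominance `DomZero 2` reaches seven tabled LIVENESS rows — M 67, M 144 + the by-product rows contactC / highContactC / quinticP / RC2 / GC2 «reachable, not instantiated»); LABEL OF RECORD: literature KNOWN TOOL (Siegel 1926 / LeVeque 1964; AEC IX.4.3; B–G 5.2.1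 for U) · tree-NEW PROVED THEOREM · problem-relative NEW LEVER on the K-line (the first genus-≥ 2 class decided; integral-point Siegel consumed directly); TALLY lens-1 ×20 + THEOREM ×22; RULE K-R54 FIXED ((i) toolkit ∪= integral-point Siegel in general = ×0-as-record after node 23; (ii) open territory at m₀ = 2 := K-R53 (ii) territory not reached by (i) ∪ K-R53 (i), two named sectors with standing witnesses W4 (non-dominant) and X3 (dominant-far); (iii) payable clause; (iv) unconditional part ∪= the node-23 tree names after the port); lens DONE L2909; PORT GO L2908 exactly as census STAGING NOTE 13 L2905 (five parts; the one pre-emptive privatisation accepted; chain import as staged). Port by census-1 gen 24 per NODE-g62.md §(11) as `RootDecomp1KHyperellipticSiegel01–05` (`--supports stmt-Schanuel-33364`; the item stays OPEN; no census credit): 01 = §L Siegel's theorem for y² = f(x) in full (sections Parity, Cofactor; `exists_numberField_forall_isSquare_of_even`; `finite_integer_sq_eq_of_unitEquation` with the tree's U-binder verbatim; `finite_integer_sq_eq` unconditional) — the ONLY part whose proofs touch Literature names, all CITED by name (`finite_unitEquation`, `finite_integer_sq_eq_cubic_of_unitEquation`, `exists_numberField_forall_mem_selmerGroup_isSquare`,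 `exists_finite_forall_mem_integer_algebraMap`, `IsDedekindDomain.mk_mem_selmerGroup_iff`, `setOf_valuation_ne_one_finite`, `setOf_one_lt_valuation_finite`), never restated; 02 = §E the engine on dominant x-degree-2 pairs (`pDisc`, `xDisc_xPolyP_two`, `sq_eq_aeval_pDisc`, `den_dvd_of_dyadic`, `badT`, `ordinate_mem_integer`, `fibrePoly_ne_zero`, `finite_ordinates_dom2` … `finite_pointed_levels_dom2`) + §E′ the intrinsic class (`DomHyper`, `domHyper_xPolyP_iff`, `thinFibreAt_of_domHyper`, `levelFinite_of_domHyper`, `siegelClause_of_domHyper`, `bddLevelEmpty_of_domHyper`, …) (section Engine); 03 = §F the family M j (`mQ`, `mC`, `M`, `mD`, `isEisensteinAt_mD`, `domHyper_M`, `levelFinite_M`, `thinFibreAt_M`, `bddLevelEmpty_M`, `siegelClause_M`, `finite_dyadicPoints_M`) (section Family); 04 = §T part 1 (numerology, shape refusals, `presentation_M`, rootless / decided / slope / local / Gauss refusals, `thinFibreAt_M_of_three_le`, `irreducible_xDisc_M`) (section Territory, to be continued); 05 = §T part 2 (the anchor (1, −1), odd/tangent-emptiness refusals, real roots, (T-2)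 `den_pow_five_le_M` / `den_pow_lt_M` / `not_thin_ineq_two_M`, `thinFibreAt_two_iff_levelFinite_M`, `M_territory`, `M'`, `M'_zero` / `M'_one`, `M'_territory`) (section Territory re-opened with K's own open-lines). Text = K VERBATIM (every declaration of K is documented by the lens; statements and proofs unchanged; the module docstring of K kept in part 01 below this provenance block).)
-/

/-!
# RootDecomp1KHyperellipticSiegel — lens 1, generation 62, NODE 23 «HYPERELLIPTIC SIEGEL ON THE K-LINE — the
# dominant live sector» (CLAIM L2879, PRICE L2882)

§L  SIEGEL'S THEOREM FOR `y² = f(x)` IN FULL (Silverman AEC Thm. IX.4.3: `f ∈ L[X]` separable of degree `≥ 3`, `L` any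
    number field, `T` any finite set of finite places; `{x ∈ R_T | ∃ y, y² = f(x)}` finite) — PROVED from the tree's unit
    equation (`Literature.NumberTheory.DiophantineGeometry.finite_unitEquation`, Bombieri–Gubler Thm. 5.2.1) by
    reduction to the tree's cubic case `finite_integer_sq_eq_cubic_of_unitEquation` over the splitting field: the
    `n`-root PARITY lemma (`two_dvd_log_map_sub_of_sq_eq_mul_prod`, `two_dvd_log_cofactor`) puts the cofactor
    `lc·∏_{other roots}(x − e)` into `F₁(T₁, 2)`, the FIELD TOWER `F₁ ⊆ F₂` adjoins its square root
    (`exists_numberField_forall_isSquare_of_even`, from Mathlib's `selmerGroup` and the tree's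
    `exists_numberField_forall_mem_selmerGroup_isSquare`), and the cubic theorem applies over `F₂`.  Both forms:
    `finite_integer_sq_eq_of_unitEquation` (the `U`-binder VERBATIM as in the cubic theorem) and `finite_integer_sq_eq`
    (unconditional).  §L imports / uses NOTHING from the K-line.
§E  THE ENGINE ON THE K-LINE: for a pair `P = c₂(Y)x² + c₁(Y)x + c₀(Y) ∈ ℤ[x][Y]` with `c₀` DOMINANT
    (`deg c₁, deg c₂ < deg c₀`: node 15's `DomZero 2 c`) whose `x`-DISCRIMINANT `Δ = c₁² − 4c₀c₂` — COMPUTED FROM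
    `P` (`pDisc c = xDisc (xPolyP 2 c)`, the tree's intrinsic `xDisc` of node 20) — is SEPARABLE of degree `≥ 3`:
    at a rational point `(ξ, r)` with DYADIC `ξ`, `r` is `T`-integral (`T` = primes of `2·lc(c₀)`; Gauss's lemma on
    the cleared polynomial: `den_dvd_of_dyadic`, `ordinate_mem_integer`) and `u := 2c₂(r)ξ + c₁(r)` satisfies
    `u² = Δ(r)` (`sq_eq_aeval_pDisc`); §L leaves finitely many `r`, separability of `Δ` excludes degenerate fibres
    (`fibrePoly_ne_zero`), so finitely many `ξ`: `SiegelClause` (disjunct (A)) ∧ `LevelFinite` ∧ `∀ m₀, ThinFibreAt m₀`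
    ∧ `BddLevelEmpty` ∧ «all but finitely many levels carry no rational point», through the record's own doors
    `levelFinite_of_siegelClause` / `thinFibreAt_of_levelFinite` / `bddLevelEmpty_iff_levelFinite`.  NO slope
    condition, NO root condition, NO local datum, ANY genus `≥ 1`.
§E′ THE CLASS INTRINSIC IN `P` (census convention): `DomHyper P` := `xdeg P = 2 ∧` dominance `∧ xDisc P` separable over
    `ℚ ∧ 3 ≤ deg xDisc P`; `thinFibreAt_of_domHyper : DomHyper P → ThinFibreAt m₀ P` etc.
§F  THE FAMILY `M j := x² + 3Y·x + (Y⁵ + 9jY + 9j + 3)`, `j ∈ ℤ`: `Δ_j = −4Y⁵ + 9Y² − 36jY − 36j − 12` is 3-EISENSTEIN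
    for EVERY `j` (`isEisensteinAt_mD`) ⇒ irreducible ⇒ separable: `domHyper_M`, and `levelFinite_M`,
    `thinFibreAt_M (j) (m₀)`, `bddLevelEmpty_M`, `siegelClause_M` HYPOTHESIS-FREE `∀ j ∈ ℤ`.
§T  TERRITORY `M_territory (j)` by tree names: `x`-degree 2, `Y`-degree 5, CONSTANT top, `eTop = 5`, `thinThreshold = 6`,
    refused by every decided class of record at `m₀ = 2` (`¬ DecidedAt 2`, `¬ LocalAt 2`, `¬ GaussAt 2` — SLOPE FAILS —,
    `¬ HeightDecidedAt 2`, `¬ SepTopAt 2`, `¬ RootlessTop e` for `e ≤ 4`, not x-linear / two-term / norm / `CB` / `VW` /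
    `SW` / `dsP` shape, `¬ OddEmptyAt ℓ`, `¬ TangentEmptyAt ℓ` at every `ℓ` by the smooth ANCHOR POINT `(1, −1)` = a
    LEVEL-1 point), GENUS TWO (`Δ_x` a ℚ-irreducible QUINTIC), REAL-LIVE at every level, and (T-2) 2-ADICALLY LIVE BY
    SIZE: at every level point `den(r)⁵ ≤ 2^{2·N!}`, so `den(r)^{2N} < 2^{(N+1)!}` — node 15's quality-2 inequality
    FAILS at every level point and `ThinFibreAt 2 (M j) ↔ LevelFinite (M j)`; pinned subfamily `M′ j := M (77j + 67)`.
HONESTY.  Rung 0 of the K-line: `FiniteOrderLiouvilleSchanuel` (item 33364), 33363, 31077, 31987, the uniform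
`ThinFibre 2`, and every binder of record are UNMOVED; Siegel's theorem is INEFFECTIVE (no bound on the last pointed
level); the NON-DOMINANT sector (standing witness W4 = `(Y⁴−17)x² + (Y³+1)x + (Y+2)`, genus two) and the DOMINANT-FAR
sector of `x`-degree `≥ 3` (standing witness X3 = `x³ + Y·x + Y⁷`, census LIVENESS-v25; genus 5, non-hyperelliptic by the
critic's certificate L2893) are NOT reached (dominance / `xdeg = 2` are hypotheses of (E)); `GaussAt 3 (M j)` holds, so
node 15 decides `M j` at every `m₀ ≥ 3` — the new content is the residual quality `m₀ = 2`.
-/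

noncomputable section

namespace Summit.Schanuel.Schanuel.Theorems.RootDecomp1KHyperellipticSiegel

open Polynomial IsDedekindDomain NumberField
open scoped Classical WithZero
open Literature.NumberTheory.DiophantineGeometry (finite_integer_sq_eq_cubic_of_unitEquation finite_unitEquation
  exists_numberField_forall_mem_selmerGroup_isSquare exists_finite_forall_mem_integer_algebraMap)
open IsDedekindDomain.HeightOneSpectrum (setOf_valuation_ne_one_finite setOf_one_lt_valuation_finite)

universe u

/-! ### §L  SIEGEL'S THEOREM FOR `y² = f(x)`, `f` SEPARABLE OF DEGREE `≥ 3` (AEC IX.4.3), FROM THE UNIT EQUATION -/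

section Parity

variable {F : Type*} [Field F] (v : Valuation F ℤᵐ⁰)

/-- **THE `n`-ROOT PARITY LEMMA** (the local computation of AEC Thm. IX.4.3, p. 244, for any number of roots): if
`y² = c·∏_{e ∈ s}(x − e)` with `v(c) = 1`, `x` and `e₀ ∈ s` integral at `v`, and `e₀ − e` a `v`-unit for every OTHER
root `e` of `s`, then `ord_v(x − e₀)` is EVEN — because at most one factor `x − e` can fail to be a `v`-unit
(for `x = e₀` the statement holds with Mathlib's junk value `log 0 = 0`). -/
theorem two_dvd_log_map_sub_of_sq_eq_mul_prod {s : Multiset F} {c x y e₀ : F}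
    (hy : y ^ 2 = c * (s.map (x - ·)).prod) (hc : v c = 1) (hx : v x ≤ 1) (he₀ : v e₀ ≤ 1)
    (hmem : e₀ ∈ s) (hdiff : ∀ e ∈ s.erase e₀, v (e₀ - e) = 1) :
    (2 : ℤ) ∣ WithZero.log (v (x - e₀)) := by
  have hprod : (s.map (x - ·)).prod = (x - e₀) * ((s.erase e₀).map (x - ·)).prod := by
    conv_lhs => rw [← Multiset.cons_erase hmem]
    rw [Multiset.map_cons, Multiset.prod_cons]
  rcases (v.map_sub_le hx he₀).lt_or_eq with hlt | heq
  · have h1 : ∀ e ∈ s.erase e₀, v (x - e) = 1 := fun e he => by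
      have hxe : x - e = (x - e₀) + (e₀ - e) := by ring
      rw [hxe, v.map_add_eq_of_lt_right (by rw [hdiff e he]; exact hlt), hdiff e he]
    have h2 : v (((s.erase e₀).map (x - ·)).prod) = 1 := by
      rw [map_multiset_prod, Multiset.map_map]
      refine Multiset.prod_eq_one fun a ha => ?_
      obtain ⟨e, he, rfl⟩ := Multiset.mem_map.mp ha
      exact h1 e he
    have key : v y ^ 2 = v (x - e₀) := by
      rw [← map_pow, hy, map_mul, hc, one_mul, hprod, map_mul, h2, mul_one]
    have hlog := congrArg WithZero.log key
    rw [WithZero.log_pow, nsmul_eq_mul] at hlog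
    push_cast at hlog
    exact ⟨WithZero.log (v y), by linarith⟩
  · rw [heq, WithZero.log_one]
    exact dvd_zero 2

end Parity

/-- the finite set of primes at which two elements `e ≠ e'` of a number field fail to differ by a unit (empty
convention for `e = e'`). -/
theorem setOf_ne_and_valuation_sub_ne_one_finite {K : Type*} [Field K] [NumberField K] (e e' : K) :
    {v : HeightOneSpectrum (𝓞 K) | e ≠ e' ∧ v.valuation K (e - e') ≠ 1}.Finite := by
  rcases eq_or_ne e e' with h | h
  · exact Set.finite_empty.subset fun v hv => absurd h hv.1
  · exact (setOf_valuation_ne_one_finite (sub_ne_zero.mpr h)).subset fun v hv => hv.2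

section Cofactor

variable {F : Type*} [Field F] (v : Valuation F ℤᵐ⁰)

/-- **PARITY OF THE COFACTOR** (AEC IX.4.3, proof, the `n`-root step): if `y² = c·∏_{e ∈ s}(x − e)` with `s` WITHOUT
REPETITION, `s = e₁, e₂, e₃, t`, and — at the place `v` — `c` and all root differences are units, `x` and the roots are
integral and `x` is not a root, then the cofactor `h = c·∏_{e ∈ t}(x − e) = y²/((x−e₁)(x−e₂)(x−e₃))` has EVEN order. -/
theorem two_dvd_log_cofactor {s t : Multiset F} {c x y e₁ e₂ e₃ : F} (hs : e₁ ::ₘ e₂ ::ₘ e₃ ::ₘ t = s)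
    (hnd : s.Nodup) (hy : y ^ 2 = c * (s.map (x - ·)).prod) (hc : v c = 1) (hx : v x ≤ 1)
    (hint : ∀ e ∈ s, v e ≤ 1) (hunit : ∀ e ∈ s, ∀ e' ∈ s, e ≠ e' → v (e - e') = 1) (hxe : ∀ e ∈ s, x - e ≠ 0) :
    (2 : ℤ) ∣ WithZero.log (v (c * (t.map (x - ·)).prod)) := by
  have he₁ : e₁ ∈ s := hs ▸ Multiset.mem_cons_self _ _
  have he₂ : e₂ ∈ s := hs ▸ Multiset.mem_cons_of_mem (Multiset.mem_cons_self _ _)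
  have he₃ : e₃ ∈ s := hs ▸ Multiset.mem_cons_of_mem (Multiset.mem_cons_of_mem (Multiset.mem_cons_self _ _))
  have hts : ∀ e ∈ t, e ∈ s := fun e he =>
    hs ▸ Multiset.mem_cons_of_mem (Multiset.mem_cons_of_mem (Multiset.mem_cons_of_mem he))
  have hpe : ∀ e₀ ∈ s, (2 : ℤ) ∣ WithZero.log (v (x - e₀)) := fun e₀ he₀ =>
    two_dvd_log_map_sub_of_sq_eq_mul_prod v hy hc hx (hint e₀ he₀) he₀ fun e he => by
      obtain ⟨hne, hes⟩ := (hnd.mem_erase_iff).mp he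
      exact hunit e₀ he₀ e hes (Ne.symm hne)
  have hprod : (s.map (x - ·)).prod = (x - e₁) * (x - e₂) * (x - e₃) * (t.map (x - ·)).prod := by
    rw [← hs]
    simp only [Multiset.map_cons, Multiset.prod_cons]
    ring
  have htprod : (t.map (x - ·)).prod ≠ 0 := by
    rw [Ne, Multiset.prod_eq_zero_iff, Multiset.mem_map]
    rintro ⟨e, he, h0⟩
    exact hxe e (hts e he) h0
  have hc0 : c ≠ 0 := fun h0 => by rw [h0, map_zero] at hc; exact zero_ne_one hc
  have hh0 : c * (t.map (x - ·)).prod ≠ 0 := mul_ne_zero hc0 htprod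
  have hid : y ^ 2 = (x - e₁) * (x - e₂) * (x - e₃) * (c * (t.map (x - ·)).prod) := by rw [hy, hprod]; ring
  obtain ⟨a₁, ha₁⟩ := hpe e₁ he₁
  obtain ⟨a₂, ha₂⟩ := hpe e₂ he₂
  obtain ⟨a₃, ha₃⟩ := hpe e₃ he₃
  have hne0 : ∀ {z : F}, z ≠ 0 → v z ≠ 0 := fun hz => (Valuation.ne_zero_iff _).mpr hz
  have hy0 : y ≠ 0 := by
    intro h0
    rw [h0, zero_pow two_ne_zero] at hid
    exact mul_ne_zero (mul_ne_zero (mul_ne_zero (hxe e₁ he₁) (hxe e₂ he₂)) (hxe e₃ he₃)) hh0 hid.symm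
  have hlog := congrArg (fun z => WithZero.log (v z)) hid
  rw [map_pow, WithZero.log_pow, nsmul_eq_mul, map_mul, map_mul, map_mul,
    WithZero.log_mul (mul_ne_zero (mul_ne_zero (hne0 (hxe e₁ he₁)) (hne0 (hxe e₂ he₂))) (hne0 (hxe e₃ he₃)))
      (hne0 hh0),
    WithZero.log_mul (mul_ne_zero (hne0 (hxe e₁ he₁)) (hne0 (hxe e₂ he₂))) (hne0 (hxe e₃ he₃)),
    WithZero.log_mul (hne0 (hxe e₁ he₁)) (hne0 (hxe e₂ he₂)), ha₁, ha₂, ha₃] at hlog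
  push_cast at hlog
  exact ⟨WithZero.log (v y) - a₁ - a₂ - a₃, by linarith⟩

end Cofactor

/-- **THE FIELD TOWER `F₁ ⊆ F₂ = F₁(√F₁(T₁,2))`** (AEC IX.4.3, proof; the `L(T,2)`/SELMER step): for a number field
`F₁` and a finite set `T₁` of finite places there is a number field `F₂ ⊇ F₁` in which EVERY `h ∈ F₁×` of EVEN ORDER
at every place outside `T₁` is a non-zero SQUARE — such an `h` defines a class of the finite group `F₁(T₁, 2)`
(Mathlib's `selmerGroup`, `IsDedekindDomain.mk_mem_selmerGroup_iff`), and the tree's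
`exists_numberField_forall_mem_selmerGroup_isSquare` adjoins the square roots of its finitely many classes. -/
theorem exists_numberField_forall_isSquare_of_even (F₁ : Type u) [Field F₁] [NumberField F₁]
    {T₁ : Set (HeightOneSpectrum (𝓞 F₁))} (hT₁ : T₁.Finite) :
    ∃ (F₂ : Type u) (_ : Field F₂) (_ : NumberField F₂) (_ : Algebra F₁ F₂),
      ∀ h : F₁, h ≠ 0 → (∀ v : HeightOneSpectrum (𝓞 F₁), v ∉ T₁ → (2 : ℤ) ∣ WithZero.log (v.valuation F₁ h)) →
        ∃ w : F₂, w ≠ 0 ∧ w ^ 2 = algebraMap F₁ F₂ h := by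
  obtain ⟨F₂, i₁, i₂, i₃, hsq⟩ := exists_numberField_forall_mem_selmerGroup_isSquare F₁ hT₁
  refine ⟨F₂, i₁, i₂, i₃, fun h hh0 hpar => ?_⟩
  have hmem : (QuotientGroup.mk (Units.mk0 h hh0) : F₁ˣ ⧸ (powMonoidHom 2 : F₁ˣ →* F₁ˣ).range) ∈
      selmerGroup (R := 𝓞 F₁) (K := F₁) (S := T₁) (n := 2) := by
    rw [IsDedekindDomain.mk_mem_selmerGroup_iff]
    intro v hv
    exact_mod_cast hpar v hv
  obtain ⟨w, hw⟩ := hsq _ hmem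
  rw [Units.val_mk0] at hw
  have hw0 : w ≠ 0 := by
    intro h0
    rw [h0, zero_pow two_ne_zero] at hw
    exact (map_ne_zero_iff _ (algebraMap F₁ F₂).injective).mpr hh0 hw.symm
  exact ⟨w, hw0, hw⟩

/-- **SILVERMAN AEC THM. IX.4.3 (SIEGEL) IN FULL, FROM THE UNIT EQUATION IX.4.1.**  Assume `U`: for every number field
`F` (in the universe of `L`) and every finite set `T` of finite places of `F`, only finitely many `T`-units `u` admit a
`T`-unit `v` with `u + v = 1`.  Then for a number field `L`, a finite set `T` of finite places and a SEPARABLE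
`f ∈ L[X]` with `3 ≤ deg f`, the set of `T`-integral `x ∈ L` with `f(x)` a square in `L` is FINITE — `y² = f(x)` has only
finitely many solutions `x ∈ R_T`, `y ∈ L`.  Proof: reduction to the cubic case of the tree
(`finite_integer_sq_eq_cubic_of_unitEquation`) over the splitting field `F₁` of `f` and the field `F₂ = F₁(√F₁(T₁,2))`:
outside a finite `T₁` the cofactor `h = lc(f)·∏_{e ≠ e₁,e₂,e₃}(x − e) = y²/((x−e₁)(x−e₂)(x−e₃))` has even order
(`two_dvd_log_map_sub_of_sq_eq_mul_prod`), so `h = w²` in `F₂` and `z = y/w` solves the cubic equation with `x ∈ R_{T₂}`. -/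
theorem finite_integer_sq_eq_of_unitEquation (L : Type u) [Field L] [NumberField L]
    (U : ∀ (F : Type u) [Field F] [NumberField F] (T : Set (HeightOneSpectrum (𝓞 F))),
      T.Finite → {u : Fˣ | u ∈ T.unit F ∧ ∃ v : Fˣ, v ∈ T.unit F ∧ (u : F) + v = 1}.Finite)
    (T : Set (HeightOneSpectrum (𝓞 L))) (hT : T.Finite) (f : L[X]) (hsep : f.Separable) (hdeg : 3 ≤ f.natDegree) :
    {x : L | x ∈ T.integer L ∧ ∃ y : L, y ^ 2 = f.eval x}.Finite := by
  -- §0 the splitting field `F₁`, the roots `s`, three of them `e₁ e₂ e₃`, the rest `t`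
  have hf0 : f ≠ 0 := by rintro rfl; simp at hdeg
  let F₁ : Type u := f.SplittingField
  haveI : NumberField F₁ := NumberField.of_module_finite L F₁
  set ι₁ : L →+* F₁ := algebraMap L F₁ with hι₁
  set f₁ : F₁[X] := f.map ι₁ with hf₁
  have hf₁0 : f₁ ≠ 0 := Polynomial.map_ne_zero hf0
  have hsplit : f₁.Splits := SplittingField.splits f
  have hsep₁ : f₁.Separable := hsep.map
  set s : Multiset F₁ := f₁.roots with hs
  have hnd : s.Nodup := nodup_roots hsep₁
  have hcard : Multiset.card s = f.natDegree := by
    rw [hs, ← hsplit.natDegree_eq_card_roots, hf₁, natDegree_map]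
  set lc : F₁ := f₁.leadingCoeff with hlc_def
  have hlc : lc ≠ 0 := leadingCoeff_ne_zero.mpr hf₁0
  have heval : ∀ x : F₁, f₁.eval x = lc * (s.map (x - ·)).prod := hsplit.eval_eq_prod_roots
  obtain ⟨e₁, he₁⟩ : ∃ e, e ∈ s := Multiset.card_pos_iff_exists_mem.mp (by omega)
  have hc1 : Multiset.card (s.erase e₁) = f.natDegree - 1 := by
    rw [Multiset.card_erase_of_mem he₁, hcard]; rfl
  obtain ⟨e₂, he₂⟩ : ∃ e, e ∈ s.erase e₁ := Multiset.card_pos_iff_exists_mem.mp (by omega)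
  have hc2 : Multiset.card ((s.erase e₁).erase e₂) = f.natDegree - 1 - 1 := by
    rw [Multiset.card_erase_of_mem he₂, hc1]; rfl
  obtain ⟨e₃, he₃⟩ : ∃ e, e ∈ (s.erase e₁).erase e₂ := Multiset.card_pos_iff_exists_mem.mp (by omega)
  obtain ⟨h21, he₂s⟩ := (hnd.mem_erase_iff).mp he₂
  obtain ⟨h32, he₃s'⟩ := ((hnd.erase e₁).mem_erase_iff).mp he₃
  obtain ⟨h31, he₃s⟩ := (hnd.mem_erase_iff).mp he₃s'
  set t : Multiset F₁ := ((s.erase e₁).erase e₂).erase e₃ with ht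
  have hts : ∀ e ∈ t, e ∈ s := fun e he =>
    Multiset.mem_of_mem_erase (Multiset.mem_of_mem_erase (Multiset.mem_of_mem_erase he))
  have hs_eq : e₁ ::ₘ e₂ ::ₘ e₃ ::ₘ t = s := by
    rw [ht, Multiset.cons_erase he₃, Multiset.cons_erase he₂, Multiset.cons_erase he₁]
  have hprod : ∀ x : F₁, (s.map (x - ·)).prod = (x - e₁) * (x - e₂) * (x - e₃) * (t.map (x - ·)).prod := by
    intro x
    rw [← hs_eq]
    simp only [Multiset.map_cons, Multiset.prod_cons]
    ring
  -- §1 the enlarged finite set of places `T₁` of `F₁`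
  obtain ⟨TF, hTF, hint⟩ := exists_finite_forall_mem_integer_algebraMap L F₁ hT
  let T₁ : Set (HeightOneSpectrum (𝓞 F₁)) :=
    TF ∪ {v | v.valuation F₁ lc ≠ 1} ∪ (⋃ e ∈ s.toFinset, {v | 1 < v.valuation F₁ e}) ∪
      ⋃ e ∈ s.toFinset, ⋃ e' ∈ s.toFinset, {v | e ≠ e' ∧ v.valuation F₁ (e - e') ≠ 1}
  have hT₁ : T₁.Finite := by
    refine ((hTF.union (setOf_valuation_ne_one_finite hlc)).union
      (Set.Finite.biUnion s.toFinset.finite_toSet fun e _ => setOf_one_lt_valuation_finite e)).union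
      (Set.Finite.biUnion s.toFinset.finite_toSet fun e _ =>
        Set.Finite.biUnion s.toFinset.finite_toSet fun e' _ => setOf_ne_and_valuation_sub_ne_one_finite e e')
  have hTF₁ : ∀ v, v ∉ T₁ → v ∉ TF := fun v hv h => hv (Or.inl (Or.inl (Or.inl h)))
  have hlc₁ : ∀ v, v ∉ T₁ → v.valuation F₁ lc = 1 := fun v hv => by
    by_contra h; exact hv (Or.inl (Or.inl (Or.inr h)))
  have hint₁ : ∀ v, v ∉ T₁ → ∀ e ∈ s, v.valuation F₁ e ≤ 1 := fun v hv e he => by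
    by_contra h
    exact hv (Or.inl (Or.inr (Set.mem_biUnion (Multiset.mem_toFinset.mpr he) (not_le.mp h))))
  have hunit₁ : ∀ v, v ∉ T₁ → ∀ e ∈ s, ∀ e' ∈ s, e ≠ e' → v.valuation F₁ (e - e') = 1 := fun v hv e he e' he' hne => by
    by_contra h
    exact hv (Or.inr (Set.mem_biUnion (Multiset.mem_toFinset.mpr he)
      (Set.mem_biUnion (Multiset.mem_toFinset.mpr he') ⟨hne, h⟩)))
  -- §2 the field `F₂ = F₁(√F₁(T₁,2))` (`exists_numberField_forall_isSquare_of_even`) and a finite `T₂`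
  obtain ⟨F₂, _, _, _, hsq⟩ := exists_numberField_forall_isSquare_of_even F₁ hT₁
  obtain ⟨T₂, hT₂, hint₂⟩ := exists_finite_forall_mem_integer_algebraMap F₁ F₂ hT₁
  set ι₂ : F₁ →+* F₂ := algebraMap F₁ F₂ with hι₂
  have h12' : ι₂ e₁ ≠ ι₂ e₂ := fun h => h21 (ι₂.injective h).symm
  have h13' : ι₂ e₁ ≠ ι₂ e₃ := fun h => h31 (ι₂.injective h).symm
  have h23' : ι₂ e₂ ≠ ι₂ e₃ := fun h => h32 (ι₂.injective h).symm
  have hA := finite_integer_sq_eq_cubic_of_unitEquation F₂ U T₂ hT₂ (ι₂ e₁) (ι₂ e₂) (ι₂ e₃) h12' h13' h23'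
  -- §3 every solution maps into `A ∪ ι₂(roots)`
  refine Set.Finite.of_finite_image (f := fun x : L => ι₂ (ι₁ x))
    ((hA.union ((s.toFinset.finite_toSet.image ι₂))).subset ?_) (ι₂.injective.comp ι₁.injective).injOn
  rintro _ ⟨x, ⟨hx, y, hy⟩, rfl⟩
  set x₁ : F₁ := ι₁ x with hx₁
  set y₁ : F₁ := ι₁ y with hy₁
  have hy₁sq : y₁ ^ 2 = lc * (s.map (x₁ - ·)).prod := by
    rw [← heval, hy₁, hx₁, ← map_pow, hy, hf₁, eval_map, eval₂_at_apply]
  by_cases hroot : x₁ ∈ s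
  · exact Or.inr ⟨x₁, Multiset.mem_toFinset.mpr hroot, rfl⟩
  refine Or.inl ?_
  have hxe : ∀ e ∈ s, x₁ - e ≠ 0 := fun e he h => hroot (by rwa [← sub_eq_zero.mp h] at he)
  have hx₁int : x₁ ∈ T₁.integer F₁ := fun v hv => hint x hx v (hTF₁ v hv)
  -- the cofactor `h`, of even order outside `T₁` (`two_dvd_log_cofactor`), is a square `w²` in `F₂`
  set h : F₁ := lc * (t.map (x₁ - ·)).prod with hh
  have htprod : (t.map (x₁ - ·)).prod ≠ 0 := by
    rw [Ne, Multiset.prod_eq_zero_iff, Multiset.mem_map]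
    rintro ⟨e, he, h0⟩
    exact hxe e (hts e he) h0
  have hh0 : h ≠ 0 := mul_ne_zero hlc htprod
  have hid : y₁ ^ 2 = (x₁ - e₁) * (x₁ - e₂) * (x₁ - e₃) * h := by
    rw [hy₁sq, hprod, hh]; ring
  have hpar : ∀ v : HeightOneSpectrum (𝓞 F₁), v ∉ T₁ → (2 : ℤ) ∣ WithZero.log (v.valuation F₁ h) := fun v hv =>
    two_dvd_log_cofactor (v.valuation F₁) hs_eq hnd hy₁sq (hlc₁ v hv) (hx₁int v hv) (hint₁ v hv) (hunit₁ v hv) hxe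
  obtain ⟨w, hw0, hw⟩ := hsq h hh0 hpar
  -- the point of the cubic over `F₂`
  refine ⟨fun v hv => hint₂ x₁ hx₁int v hv, ι₂ y₁ / w, ?_⟩
  rw [div_pow, ← map_pow, hid, map_mul, ← hw, mul_div_cancel_right₀ _ (pow_ne_zero 2 hw0), map_mul, map_mul,
    map_sub, map_sub, map_sub]

/-- **SIEGEL'S THEOREM FOR `y² = f(x)` — UNCONDITIONAL** (AEC Thm. IX.4.3; Siegel 1926, LeVeque 1964): for a number
field `L`, a finite set `T` of finite places and a separable `f ∈ L[X]` of degree `≥ 3`, only finitely many `T`-integers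
`x` make `f(x)` a square in `L`.  The unit equation is the tree's PROVED `finite_unitEquation` (Bombieri–Gubler 5.2.1). -/
theorem finite_integer_sq_eq (L : Type u) [Field L] [NumberField L] (T : Set (HeightOneSpectrum (𝓞 L)))
    (hT : T.Finite) (f : L[X]) (hsep : f.Separable) (hdeg : 3 ≤ f.natDegree) :
    {x : L | x ∈ T.integer L ∧ ∃ y : L, y ^ 2 = f.eval x}.Finite :=
  finite_integer_sq_eq_of_unitEquation L (fun F _ _ T' hT' => finite_unitEquation F T' hT') T hT f hsep hdeg

end Summit.Schanuel.Schanuel.Theorems.RootDecomp1KHyperellipticSiegel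

end
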